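/-
Copyright (c) 2026 the pub-hodgecm-mathlib formalisation cell (harness21).  Prover seat hodgecm-mathlib-K2E5-p16 (g4): Track B «K2-LIT»,
hLiu418 = stmt-HodgeConjecture-24832, ROAD Φ organ Φ6b-3, SINGULAR HALF (dealer K2E5-plan (g5) 2026-09-04T06:21:58Z: «Road Φ needs rank-1 β at
n = 2 (Φ7) and Road I's payer of (A3)_τ needs exactly the rank-1 profile ξ(y, diag(t,0); α, β)»): the ξ–η identity for SEMIDEFINITE `h ≥ 0`; 2026-09-04.
-/
import Summits.HodgeConjecture.HodgeConjecture.Theorems.K2LiuHermTwoXiEtaIdentity              -- ★ p858047 (this seat): the `h > 0` identity + tools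
import HarnessLib

/-!
# Crux `HLiu418`, ROAD Φ, organ Φ6b-3 (singular half): the ξ–η identity for SEMIDEFINITE `h ≥ 0` [Shimura1982, (1.29), Case II, m = κ = 2]
# `ξ(g, h; α, β) = 4π⁴ · e^{iπ(β−α)} · Γ₂(α)⁻¹ Γ₂(β)⁻¹ · η(2g, πh; α, β)`   (`g > 0`, `h ≥ 0` of any rank, `re α > 3`, `re β > 1`)

Cell `hodgecm-mathlib`, crux item hLiu418 = `stmt-HodgeConjecture-24832`, route of record `HCCMUnconditional`; squad K2, LEAD F0P6-plan (g12), co-dealer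
K2E5-plan (g5), prover K2E5-p16 (g4).  THEOREMS ONLY; lane `--supports stmt-HodgeConjecture-24832 --as helper`.

WHAT.  ★ `xiTwo_eq_etaTwo` (file `K2LiuHermTwoXiEtaIdentity`) is the identity for `h > 0`.  Its proof uses positivity of `h` at exactly two places —
`w = u + 2πh` lies in the open cone for `u` in the open cone, and `{x ± πh > 0} = {x − πh > 0}` — and both hold verbatim for `h ≥ 0`.  This file
records the identity for every positive SEMIdefinite `h` (`xiTwo_eq_etaTwo_of_posSemidef`), in particular for the SINGULAR rank-1 profiles
`h = diag(t, 0)` (up to unitary conjugation) that Road I's payer of (A3)_τ and Road Φ's rank-1 Fourier coefficient at `n = 2` consume, and for `h = 0`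
(where `η(2g, 0; α, β) = Γ₂(α + β − 2) det(2g)^{2−α−β}` by ★ `integral_siegelGindikin`).  Together with ★ `integrableOn_etaTwoIntegrand_of_posSemidef`
(absolute convergence of the right-hand side on `re β > 1 ∧ re(α+β) > 3`) this is the `h ≥ 0` row of the ξ-sheet.
HONEST LABEL.  Count-neutral helper of the K2_Liu road; it pays no socket by itself: `HC_CM` is proved only modulo the 7 printed citations
(2 remaining named inputs: hLiu418 = `stmt-HodgeConjecture-24832`, h413 = `stmt-HodgeConjecture-24833`) until rung 0 closes.
-/

set_option autoImplicit false
-- the mandated namespace repeats the single-problem summit's segment (`HodgeConjecture.HodgeConjecture`)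
set_option linter.dupNamespace false

noncomputable section

open Complex MeasureTheory Set
open scoped ComplexOrder ComplexConjugate

namespace Summit.HodgeConjecture.HodgeConjecture.Cruxes.HLiu418.K2LiuHermTwoXiEtaIdentitySemidefinite

open Summit.HodgeConjecture.HodgeConjecture.Cruxes.HLiu418.K2LiuHermTwoGammaDefs
open Summit.HodgeConjecture.HodgeConjecture.Cruxes.HLiu418.K2LiuHermTwoGammaSiegelGindikin
open Summit.HodgeConjecture.HodgeConjecture.Cruxes.HLiu418.K2LiuHermTwoGammaKernelFourier
open Summit.HodgeConjecture.HodgeConjecture.Cruxes.HLiu418.K2LiuHermTwoGammaKernelInversion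
open Summit.HodgeConjecture.HodgeConjecture.Cruxes.HLiu418.K2LiuHermTwoDetPowerIntegrable
open Summit.HodgeConjecture.HodgeConjecture.Cruxes.HLiu418.K2LiuHermTwoConfluentXiDefs
open Summit.HodgeConjecture.HodgeConjecture.Cruxes.HLiu418.K2LiuHermTwoConfluentXiConvergence
open Summit.HodgeConjecture.HodgeConjecture.Cruxes.HLiu418.K2LiuHermTwoEtaDefs
open Summit.HodgeConjecture.HodgeConjecture.Cruxes.HLiu418.K2LiuHermTwoXiEtaIdentity

/-! ## Semidefinite chart points -/

/-- The sum of a cone point and a SEMIdefinite chart point is a cone point. -/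
theorem posDef_hermTwo_add_of_posSemidef {u e : ℝ × ℂ × ℝ} (hu : (hermTwo u).PosDef) (he : (hermTwo e).PosSemidef) :
    (hermTwo (u + e)).PosDef := by
  rw [hermTwo_add]
  exact hu.add_posSemidef he

/-- A nonnegative multiple of a SEMIdefinite chart point is SEMIdefinite. -/
theorem posSemidef_hermTwo_smul {r : ℝ} (hr : 0 ≤ r) {e : ℝ × ℂ × ℝ} (he : (hermTwo e).PosSemidef) : (hermTwo (r • e)).PosSemidef := by
  refine Matrix.PosSemidef.of_dotProduct_mulVec_nonneg (isHermitian_hermTwo (r • e)) fun x => ?_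
  rw [hermTwo_smul, Matrix.smul_mulVec, dotProduct_smul, smul_eq_mul]
  exact mul_nonneg (Complex.zero_le_real.mpr hr) (he.dotProduct_mulVec_nonneg x)

/-! ## The inner integral and the translation, for `h ≥ 0` -/

/-- For `u` in the cone and `h = hermTwo e ≥ 0`: `∫_x e(−τ(hx)) e^{−iτ(ux)} det(g − ix)^{−α} dx = 4π⁴ Γ₂(α)⁻¹ e^{−τ((u+2πh)g)} det(u+2πh)^{α−2}`. -/
theorem inner_integral_eq_of_posSemidef {g : Matrix (Fin 2) (Fin 2) ℂ} (hg : g.PosDef) {e : ℝ × ℂ × ℝ} (he : (hermTwo e).PosSemidef) {α : ℂ} (hα : 3 < α.re)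
    {u : ℝ × ℂ × ℝ} (hu : (hermTwo u).PosDef) :
    ∫ c : ℝ × ℂ × ℝ, cexp (-(2 * Real.pi * I) * (hermTwo e * hermTwo c).trace) * cexp (-(I * (hermTwo u * hermTwo c).trace)) *
        (g - I • hermTwo c).det ^ (-α) =
      ((4 * Real.pi ^ 4 : ℝ) : ℂ) * (hermTwoGamma α)⁻¹ *
        (cexp (-(hermTwo (u + (2 * Real.pi) • e) * g).trace) * (hermTwo (u + (2 * Real.pi) • e)).det ^ (α - 2)) := by
  have hw : (hermTwo (u + (2 * Real.pi) • e)).PosDef := posDef_hermTwo_add_of_posSemidef hu (posSemidef_hermTwo_smul (by positivity) he)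
  have hΓ : hermTwoGamma α ≠ 0 := hermTwoGamma_ne_zero (by linarith)
  have key := integral_cexp_trace_mul_det_cpow hg hα hw
  have h1 : (fun c : ℝ × ℂ × ℝ => cexp (-(2 * Real.pi * I) * (hermTwo e * hermTwo c).trace) *
      cexp (-(I * (hermTwo u * hermTwo c).trace)) * (g - I • hermTwo c).det ^ (-α)) =
      fun c => (hermTwoGamma α)⁻¹ * (cexp (-(I * (hermTwo (u + (2 * Real.pi) • e) * hermTwo c).trace)) *
        (hermTwoGamma α * (g - I • hermTwo c).det ^ (-α))) := by
    funext c
    rw [phase_combine]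
    field_simp
  rw [h1, integral_const_mul, key]
  ring

/-- `∫_{u > 0} e^{−τ(ug)} det(u)^{β−2} · e^{−τ((u+2πh)g)} det(u + 2πh)^{α−2} du = η(2g, πh; α, β)` (translation `x = u + πh`, `h = hermTwo e ≥ 0`). -/
theorem integral_kernel_shift_eq_etaTwo_of_posSemidef (g : Matrix (Fin 2) (Fin 2) ℂ) {e : ℝ × ℂ × ℝ} (he : (hermTwo e).PosSemidef) (α β : ℂ) :
    ∫ u : ℝ × ℂ × ℝ, {x : ℝ × ℂ × ℝ | (hermTwo x).PosDef}.indicator (fun x => cexp (-(hermTwo x * g).trace) * (hermTwo x).det ^ (β - 2)) u *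
        (cexp (-(hermTwo (u + (2 * Real.pi) • e) * g).trace) * (hermTwo (u + (2 * Real.pi) • e)).det ^ (α - 2)) =
      etaTwo ((2 : ℂ) • g) ((Real.pi : ℂ) • hermTwo e) α β := by
  have hπe : (hermTwo (Real.pi • e)).PosSemidef := posSemidef_hermTwo_smul Real.pi_pos.le he
  rw [← hermTwo_smul Real.pi e, etaTwo_def, etaTwoSet_eq_of_posSemidef hπe]
  -- the translation `x = u + πh` preserves Lebesgue measure
  have hT : MeasurePreserving (fun c : ℝ × ℂ × ℝ => c + Real.pi • e) volume volume := by
    have h := (measurePreserving_add_right (volume : Measure ℝ) (Real.pi • e).1).prod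
      ((measurePreserving_add_right (volume : Measure ℂ) (Real.pi • e).2.1).prod
        (measurePreserving_add_right (volume : Measure ℝ) (Real.pi • e).2.2))
    have hf : (fun c : ℝ × ℂ × ℝ => c + Real.pi • e) =
        Prod.map (fun x : ℝ => x + (Real.pi • e).1) (Prod.map (fun x : ℂ => x + (Real.pi • e).2.1) (fun x : ℝ => x + (Real.pi • e).2.2)) := by
      funext c
      rfl
    rw [hf, Measure.volume_eq_prod, Measure.volume_eq_prod]
    exact h
  have hTe : MeasurableEmbedding (fun c : ℝ × ℂ × ℝ => c + Real.pi • e) := (MeasurableEquiv.addRight (Real.pi • e)).measurableEmbedding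
  have hpre : (fun c : ℝ × ℂ × ℝ => c + Real.pi • e) ⁻¹' {c | (hermTwo c - hermTwo (Real.pi • e)).PosDef} = {c | (hermTwo c).PosDef} := by
    ext c
    simp only [Set.mem_preimage, Set.mem_setOf_eq, hermTwo_add, add_sub_cancel_right]
  rw [← hT.setIntegral_preimage_emb hTe _ {c | (hermTwo c - hermTwo (Real.pi • e)).PosDef}, hpre,
    ← integral_indicator measurableSet_posDef_hermTwo]
  refine integral_congr_ae (Filter.Eventually.of_forall fun u => ?_)
  beta_reduce
  by_cases hu : (hermTwo u).PosDef
  · rw [gammaKernel_eq_of_posDef g β hu, indicator_of_mem (show u ∈ {c : ℝ × ℂ × ℝ | (hermTwo c).PosDef} from hu),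
      etaTwoIntegrand_apply]
    have hadd : hermTwo (u + Real.pi • e) + hermTwo (Real.pi • e) = hermTwo (u + (2 * Real.pi) • e) := by
      rw [← hermTwo_add, two_mul, add_smul, add_assoc]
    have hsub : hermTwo (u + Real.pi • e) - hermTwo (Real.pi • e) = hermTwo u := by
      rw [hermTwo_add, add_sub_cancel_right]
    rw [hadd, hsub, ← trace_combine g e u, neg_add, Complex.exp_add]
    ring
  · rw [gammaKernel_eq_zero_of_not_posDef g β hu, indicator_of_notMem (show u ∉ {c : ℝ × ℂ × ℝ | (hermTwo c).PosDef} from hu),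
      zero_mul]

/-! ## The identity for `h ≥ 0` -/

/-- **THE ξ–η IDENTITY FOR SEMIDEFINITE `h ≥ 0`** (organ Φ6b-3, singular half; [Shimura1982, (1.29), Case II, m = κ = 2]): for a positive
definite `g`, a positive SEMIdefinite `h` (rank `0`, `1` or `2`) and `re α > 3`, `re β > 1`,
  `ξ(g, h; α, β) = 4π⁴ · e^{iπ(β−α)} · Γ₂(α)⁻¹ · Γ₂(β)⁻¹ · η(2g, πh; α, β)`. -/
theorem xiTwo_eq_etaTwo_of_posSemidef {g h : Matrix (Fin 2) (Fin 2) ℂ} (hg : g.PosDef) (hh : h.PosSemidef) {α β : ℂ} (hα : 3 < α.re) (hβ : 1 < β.re) :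
    xiTwo g h α β =
      ((4 * Real.pi ^ 4 : ℝ) : ℂ) * cexp ((Real.pi * I) * (β - α)) * (hermTwoGamma α)⁻¹ * (hermTwoGamma β)⁻¹ *
        etaTwo ((2 : ℂ) • g) ((Real.pi : ℂ) • h) α β := by
  -- coordinates of `h`
  obtain ⟨e, rfl⟩ : ∃ e : ℝ × ℂ × ℝ, hermTwo e = h := ⟨_, hermTwo_eq_of_isHermitian hh.1⟩
  have hΓα : hermTwoGamma α ≠ 0 := hermTwoGamma_ne_zero (by linarith)
  have hΓβ : hermTwoGamma β ≠ 0 := hermTwoGamma_ne_zero hβ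
  -- (1) insert the tube formula for `det(g + ix)^{−β}` and (2) Fubini
  have hG := integrable_double hg e hα hβ
  have step1 : xiTwo g (hermTwo e) α β = cexp ((Real.pi * I) * (β - α)) * (hermTwoGamma β)⁻¹ *
      ∫ c : ℝ × ℂ × ℝ, ∫ u : ℝ × ℂ × ℝ,
        cexp (-(2 * Real.pi * I) * (hermTwo e * hermTwo c).trace) * (g - I • hermTwo c).det ^ (-α) *
          ({x : ℝ × ℂ × ℝ | (hermTwo x).PosDef}.indicator (fun x => cexp (-(hermTwo x * g).trace) * (hermTwo x).det ^ (β - 2)) u *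
            cexp (-(I * (hermTwo u * hermTwo c).trace))) := by
    rw [xiTwo_def, ← integral_const_mul]
    refine integral_congr_ae (Filter.Eventually.of_forall fun c => ?_)
    beta_reduce
    rw [xiTwoIntegrand_eq, integral_const_mul, integral_gammaKernel_mul_cexp_trace hg hβ c]
    field_simp
  rw [step1, integral_integral_swap hG]
  -- (3) the inner integral, pointwise in `u`
  have step3 : (fun u : ℝ × ℂ × ℝ => ∫ c : ℝ × ℂ × ℝ,
        cexp (-(2 * Real.pi * I) * (hermTwo e * hermTwo c).trace) * (g - I • hermTwo c).det ^ (-α) *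
          ({x : ℝ × ℂ × ℝ | (hermTwo x).PosDef}.indicator (fun x => cexp (-(hermTwo x * g).trace) * (hermTwo x).det ^ (β - 2)) u *
            cexp (-(I * (hermTwo u * hermTwo c).trace)))) =
      fun u => ((4 * Real.pi ^ 4 : ℝ) : ℂ) * (hermTwoGamma α)⁻¹ *
        ({x : ℝ × ℂ × ℝ | (hermTwo x).PosDef}.indicator (fun x => cexp (-(hermTwo x * g).trace) * (hermTwo x).det ^ (β - 2)) u *
          (cexp (-(hermTwo (u + (2 * Real.pi) • e) * g).trace) * (hermTwo (u + (2 * Real.pi) • e)).det ^ (α - 2))) := by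
    funext u
    by_cases hu : (hermTwo u).PosDef
    · have h1 : (fun c : ℝ × ℂ × ℝ =>
          cexp (-(2 * Real.pi * I) * (hermTwo e * hermTwo c).trace) * (g - I • hermTwo c).det ^ (-α) *
            ({x : ℝ × ℂ × ℝ | (hermTwo x).PosDef}.indicator (fun x => cexp (-(hermTwo x * g).trace) * (hermTwo x).det ^ (β - 2)) u *
              cexp (-(I * (hermTwo u * hermTwo c).trace)))) =
          fun c => {x : ℝ × ℂ × ℝ | (hermTwo x).PosDef}.indicator
              (fun x => cexp (-(hermTwo x * g).trace) * (hermTwo x).det ^ (β - 2)) u *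
            (cexp (-(2 * Real.pi * I) * (hermTwo e * hermTwo c).trace) * cexp (-(I * (hermTwo u * hermTwo c).trace)) *
              (g - I • hermTwo c).det ^ (-α)) := by
        funext c
        ring
      rw [h1, integral_const_mul, inner_integral_eq_of_posSemidef hg hh hα hu]
      ring
    · rw [gammaKernel_eq_zero_of_not_posDef g β hu]
      simp
  rw [step3, integral_const_mul, integral_kernel_shift_eq_etaTwo_of_posSemidef g hh α β]
  ring

end Summit.HodgeConjecture.HodgeConjecture.Cruxes.HLiu418.K2LiuHermTwoXiEtaIdentitySemidefinite

end
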